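import Summits.ResolutionOfSingularities.ResolutionOfSingularities.Theorems.ChainW52TargetsF7Beta
import Summits.ResolutionOfSingularities.ResolutionOfSingularities.Theorems.FrobeniusClosingPatchingRelPerfectDepthMultiHostFormatSncCylEnd
import HarnessLib

/-!
# Crux `PatchingRelPerfect` (stmt-ResolutionOfSingularities-16161), chain W5.2 — F7(β) d = 2 (β-AX): TARGET T2c `FormatEndOnCyl₂` HOLDS

[OURS · L1 W5.2 · F7(β) (β-AX) X2c · res-L1-w52-plan-1 targets `ChainW52TargetsF7Beta.lean` (filed by res-D-repro-1 AS res-L1-repro-3, RULING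
G11-29 (3a)); proof = res-D-pv-021's `CylState.exists_isFormatSncOn_of_cjsEnd` (p551860) over res-D-pv-034's CYL-SNC (p550942).]  Replaces the
role of NO printed item; NOT a statement of the manuscript under review; fact-free.  AI-written; AI review is weaker than expert review.
No definitions.

* **`ChainW52F7Beta.formatEndOnCyl₂_holds : FormatEndOnCyl₂`** — at CJS end (one snc family on the carrier presenting the boundary traces and
  every host trace as a monomial) the multi-host state is FORMAT-SNC END on the cylinder region: the `FormatEndOnCyl₂` input of the
  composition `BetaTwoComposition₂` (T5) is discharged, fact-free.

## References
* E. Bierstone, D. Grigoriev, P. Milman, J. Włodarczyk (2011), Def. 3.1.1, Def. 3.1.3. [BierstoneGrigorievMilmanWlodarczyk2011]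
* J. Kollár, *Lectures on Resolution of Singularities* (2007), (3.111) Steps 1–3. [Kollar2007]
-/

-- `Summit.<Summit>.<Sub>.Theorems` with `Sub = Summit` (single-conjunct summit, D-0017)
set_option linter.dupNamespace false

noncomputable section

open CategoryTheory AlgebraicGeometry TopologicalSpace
open Literature.AlgebraicGeometry.Resolution Scheme.IdealSheafData

namespace Summit.ResolutionOfSingularities.ResolutionOfSingularities.Theorems.ChainW52F7Beta

universe u

/-- **T2c `FormatEndOnCyl₂` HOLDS** (fact-free): CYL-SNC (`CylState.hasSNC_cylinder`, from `CylState.param` and `S.snc`) + the host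
factorisation transported along the cylinder identities (`CylState.exists_isFormatSncOn_of_cjsEnd`, components = the member-aware
globalisations `𝓔.map cyl.globalise`). [cite: BierstoneGrigorievMilmanWlodarczyk2011, Def. 3.1.1 and Def. 3.1.3] [cite: Kollar2007, (3.111) Steps 1–3] -/
theorem formatEndOnCyl₂_holds : FormatEndOnCyl₂.{u} := by
  intro X _ hX S cyl _ _ hZ 𝓔 h𝓔 hnd hirr hbd htr
  exact DepthMultiHost.CylState.exists_isFormatSncOn_of_cjsEnd hX S cyl hZ 𝓔 h𝓔 hnd hirr hbd htr

end Summit.ResolutionOfSingularities.ResolutionOfSingularities.Theorems.ChainW52F7Beta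

end
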